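import Summits.PneNP.PneNP.Theses.DirichletPigeons

/-!
# Birth skeleton (BC3) for the split piece `MinkowskiPriceOfDimension` — line `sis-calibration`

Crux (piece 1 of the split of `GsaPriceOfDimension`, route PneNP/DirichletPigeons):
`MinkowskiPriceOfDimension : ∃ δ > 0, ¬ minkowskiInExpTime δ` — MINKOWSKI_∞ (SZZ18 §6: input a
nonsingular `B ∈ ℤ^{n×n}`, `n ≥ 1`; output `z ≠ 0` with `‖zB‖_∞ ≤ |det B|^{1/n}`) has no
`c·2^{δ n}·(L+1)^c`-time solver.

LINE `sis-calibration` (two registered stubs + the kernel-checked composition):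

* `stub_sisOfMinkowski` — the q-ARY EMBEDDING (folklore; Ajtai 1996 / Micciancio–Regev 2007
  vocabulary): a `2^{δ n}·poly` MINKOWSKI_∞ solver yields a `2^{c δ m}·poly` solver for SIS_∞ at the
  pigeonhole density — instance `(⟨m, A⟩, n, q)` (square `A ∈ ℤ^{m×m}`, only the rows `< n` are read),
  promise `1 ≤ n ≤ m`, `2 ≤ q`, `q^n < 2^m`; solution `z ∈ {-1,0,1}^m ∖ {0}` with
  `A_{[n]} z ≡ 0 (mod q)`.  Proof idea: the kernel lattice `Λ = {z ∈ ℤ^m : A_{[n]} z ≡ 0 mod q}` has a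
  poly-time HNF basis, `det Λ = [ℤ^m : Λ] ≤ q^n < 2^m`, so a MINKOWSKI_∞ solution `x ∈ Λ ∖ {0}` has
  `|x_j|^m ≤ det Λ < 2^m`, i.e. `|x_j| ≤ 1`; dimension preserved (`c = 1` up to the polynomial
  factor).  PROVABLE NOW in principle (TM plumbing: HNF machine + one oracle call), size L.
* `stub_sisFloor` — SIS_∞ at the pigeonhole threshold costs `2^{Ω(m)}` (conjecture-grade; the
  central hardness assumption of lattice cryptography in its worst-case, exact-threshold form;
  best algorithms: lattice reduction / sieving in dimension `m`, `2^{Θ(m)}`; generalized-birthday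
  attacks are subexponential only for `m ≫ n log q`).
* `MinkowskiPriceOfDimension_of : stub_sisOfMinkowski → stub_sisFloor → MinkowskiPriceOfDimension`
  (exponent bookkeeping `δ₀ = c·δ₁`).

The crux is the ROUTE DECL `Summit.PneNP.PneNP.Theses.DirichletPigeons.MinkowskiPriceOfDimension` (rev ≥ 4), imported.
-/

set_option linter.dupNamespace false

namespace Summit.PneNP.PneNP.Cruxes.GsaPriceOfDimension.SisCalibration

open scoped Classical
open Summit.PneNP.PneNP.Theses.DirichletPigeons (MinkowskiPriceOfDimension)
open Literature.Computability.Complexity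

/-! ### Named forms of the route's inline (`let`-bound) vocabulary — definitionally the let bodies -/

/-- `expPoly δ T`: `T n L ≤ c · 2^{δ n} · (L+1)^c` for some `c` (body of `FineGrained.IsExpPolyBound`). -/
def expPoly : ℝ → (ℕ → ℕ → ℕ) → Prop := fun δ T => ∃ c : ℕ, ∀ n L : ℕ, (T n L : ℝ) ≤ c * (2 : ℝ) ^ (δ * n) * ((L : ℝ) + 1) ^ c

/-- Bit code of square integer matrices `Σ n, ℤ^{n×n}` (= `LatticeInstance.encode` bit for bit). -/
def imat : Computability.Encoding (Σ n : ℕ, Matrix (Fin n) (Fin n) ℤ) Bool := Computability.Encoding.sigmaBool fun n => (Literature.Computability.Complexity.encodingFinVec Literature.Computability.Complexity.encodingIntBool (n * n)).ofEquiv (Matrix.of.symm.trans ((Equiv.curry (Fin n) (Fin n) ℤ).symm.trans (finProdFinEquiv.arrowCongr (Equiv.refl ℤ))))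

/-- MINKOWSKI_∞ solutions: `z ≠ 0 ∧ ∀ j, |(zB)_j|^n ≤ |det B|`. -/
def solM : (B : (Σ n : ℕ, Matrix (Fin n) (Fin n) ℤ)) → (Fin B.1 → ℤ) → Prop := fun B z => z ≠ 0 ∧ ∀ j : Fin B.1, |Matrix.vecMul z B.2 j| ^ B.1 ≤ |B.2.det|

/-- "MINKOWSKI_∞ ∈ FTIME(2^{δ n}·poly)". -/
def minkowskiInExpTime : ℝ → Prop := fun δ => ∃ g : (Σ n : ℕ, Matrix (Fin n) (Fin n) ℤ) → List Bool, (∀ B : (Σ n : ℕ, Matrix (Fin n) (Fin n) ℤ), B.2.det ≠ 0 → 1 ≤ B.1 → solM B (((Literature.Computability.Complexity.encodingFinVec Literature.Computability.Complexity.encodingIntBool B.1).decode (g B)).getD 0)) ∧ ∃ T : ℕ → ℕ → ℕ, expPoly δ T ∧ ∃ M, Literature.Computability.Complexity.ComputesInTime imat.encode (id : List Bool → List Bool) g (fun B => T B.1 (imat.encode B).length) M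

/-- The crux in the named vocabulary (definitional unfolding). -/
theorem minkowskiPriceOfDimension_iff :
    Summit.PneNP.PneNP.Theses.DirichletPigeons.MinkowskiPriceOfDimension ↔ ∃ δ : ℝ, 0 < δ ∧ ¬ minkowskiInExpTime δ := Iff.rfl

/-! ### SIS_∞ at the pigeonhole density (Ajtai 1996), typed over the same codes

Instance `S = (⟨m, A⟩, n, q) : (Σ m, Matrix (Fin m) (Fin m) ℤ) × ℕ × ℕ` — the matrix is stored square
(`m × m`), only its rows `r < n` are constraints; promise `1 ≤ n ≤ m`, `2 ≤ q`, `q^n < 2^m`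
(pigeonhole ⇒ a solution exists: two of the `2^m > q^n` vectors of `{0,1}^m` collide mod `q`).
Solution `z : Fin m → ℤ`: `z ≠ 0`, `|z i| ≤ 1`, `q ∣ ∑ i, A r i * z i` for every row `r < n`.
Parameter of the time bound: `m` (= the dimension of the kernel lattice). -/

/-- Bit code of SIS instances: `imat.pairBool (encodingNatBool.pairBool encodingNatBool)`. -/
def encS : ((Σ m : ℕ, Matrix (Fin m) (Fin m) ℤ) × ℕ × ℕ) → List Bool := (imat.pairBool (Computability.encodingNatBool.pairBool Computability.encodingNatBool)).encode

/-- SIS_∞ solutions (`β = 1`). -/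
def solS : (S : (Σ m : ℕ, Matrix (Fin m) (Fin m) ℤ) × ℕ × ℕ) → (Fin S.1.1 → ℤ) → Prop := fun S z => z ≠ 0 ∧ (∀ i : Fin S.1.1, |z i| ≤ 1) ∧ ∀ r : Fin S.1.1, (r : ℕ) < S.2.1 → (S.2.2 : ℤ) ∣ ∑ i : Fin S.1.1, S.1.2 r i * z i

/-- "SIS_∞ (pigeonhole density) ∈ FTIME(2^{δ m}·poly)": some `g` (codes out, decoded with
`encodingFinVec encodingIntBool m`, junk ↦ no solution) solves every promised instance, computed within
`T m L`, `expPoly δ T`. -/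
def sisInExpTime : ℝ → Prop := fun δ => ∃ g : ((Σ m : ℕ, Matrix (Fin m) (Fin m) ℤ) × ℕ × ℕ) → List Bool, (∀ S : (Σ m : ℕ, Matrix (Fin m) (Fin m) ℤ) × ℕ × ℕ, 1 ≤ S.2.1 → S.2.1 ≤ S.1.1 → 2 ≤ S.2.2 → S.2.2 ^ S.2.1 < 2 ^ S.1.1 → solS S (((Literature.Computability.Complexity.encodingFinVec Literature.Computability.Complexity.encodingIntBool S.1.1).decode (g S)).getD 0)) ∧ ∃ T : ℕ → ℕ → ℕ, expPoly δ T ∧ ∃ M, Literature.Computability.Complexity.ComputesInTime encS (id : List Bool → List Bool) g (fun S => T S.1.1 (encS S).length) M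

/-! ### Registered stubs -/

/-- STUB 1 (q-ary embedding, fine-grained, dimension-linear): a `2^{δ n}·poly` MINKOWSKI_∞ solver
gives a `2^{c δ m}·poly` SIS_∞ solver. [folklore: SIS solutions are the sup-norm-≤-1 vectors of the
q-ary kernel lattice, whose determinant is `≤ q^n < 2^m`; Ajtai 1996; Micciancio–Regev 2007 §5] -/
theorem stub_sisOfMinkowski :
    ∃ c : ℝ, 0 < c ∧ ∀ δ : ℝ, 0 < δ → minkowskiInExpTime δ → sisInExpTime (c * δ) := by
  sorry

/-- STUB 2 (the floor, conjecture-grade): SIS_∞ at the pigeonhole density has no `2^{δ m}·poly`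
solver for some `δ > 0`. [Ajtai 1996; Micciancio–Regev 2007; fine-grained lattice hardness:
Bennett–Golovnev–Stephens-Davidowitz 2017, Aggarwal–Stephens-Davidowitz 2018] -/
theorem stub_sisFloor : ∃ δ : ℝ, 0 < δ ∧ ¬ sisInExpTime δ := by
  sorry

/-! ### Kernel-checked composition -/

/-- **The line concludes the crux**: `stub_sisOfMinkowski → stub_sisFloor → MinkowskiPriceOfDimension`.
If SIS_∞ has no `2^{δ₀ m}·poly` solver and every `2^{δ n}·poly` MINKOWSKI_∞ solver yields a
`2^{c δ m}·poly` SIS_∞ solver, then MINKOWSKI_∞ has no `2^{(δ₀/c) n}·poly` solver. -/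
theorem MinkowskiPriceOfDimension_of :
    (∃ c : ℝ, 0 < c ∧ ∀ δ : ℝ, 0 < δ → minkowskiInExpTime δ → sisInExpTime (c * δ)) →
    (∃ δ : ℝ, 0 < δ ∧ ¬ sisInExpTime δ) →
    Summit.PneNP.PneNP.Theses.DirichletPigeons.MinkowskiPriceOfDimension := by
  intro hred hfloor
  rw [minkowskiPriceOfDimension_iff]
  obtain ⟨c, hc, hred⟩ := hred
  obtain ⟨δ₀, hδ₀, hnot⟩ := hfloor
  obtain ⟨δ₁, rfl⟩ : ∃ δ₁ : ℝ, δ₀ = c * δ₁ := ⟨δ₀ / c, by field_simp⟩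
  have hδ₁ : 0 < δ₁ := (mul_pos_iff_of_pos_left hc).1 hδ₀
  exact ⟨δ₁, hδ₁, fun hM => hnot (hred δ₁ hδ₁ hM)⟩

/-- **Skeleton certificate** (`ledger skeleton check`): the registered stubs prove the ROUTE DECL by name.
Depends on `sorry` exactly through the `stub_*` above. -/
theorem MinkowskiPriceOfDimension_proof : Summit.PneNP.PneNP.Theses.DirichletPigeons.MinkowskiPriceOfDimension :=
  MinkowskiPriceOfDimension_of stub_sisOfMinkowski stub_sisFloor

end Summit.PneNP.PneNP.Cruxes.GsaPriceOfDimension.SisCalibration
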